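import Literature.Computability.AlgebraicComplexity.RankOneDeterminantalExpressionsProofs
import HarnessLib

/-!
# Proof of Ikenmeyer–Landsberg 2017, Thm. 2.9 (determinant half):
# `ikenmeyerLandsberg2017_det_no_rankOne_regular_holds`

Topic `Literature/Computability/AlgebraicComplexity`; sibling of
`RankOneDeterminantalExpressions.lean` (the named facts) and of
`RankOneDeterminantalExpressionsProofs.lean` (the permanent half, whose linear algebra it reuses).
It DISCHARGES `ikenmeyerLandsberg2017_det_no_rankOne_regular` (Ikenmeyer–Landsberg 2017,
Thm. 2.9, determinant half): for `m ≥ 3` the generic determinant `det_m` has no affine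
determinantal representation `det_m = det A`, `A = Λ + Σ_e y^e X^e ∈ M_n(ℂ[y])`, which is regular
(`rank Λ = n - 1`) and rank one (`rank X^e ≤ 1` for all `e`).  Theorems only (no new definitions,
no new facts).

Source: C. Ikenmeyer, J. M. Landsberg, *On the complexity of the permanent in various
computational models*, J. Pure Appl. Algebra 221 (2017) 2911–2927 = arXiv:1610.00159
[IkenmeyerLandsberg2017], §6 (p. 10: "Theorem 2.9 will follow from Lemmas 6.2 and 6.3", both
stated there for "the permanent or determinant"; Lemma 6.2 p. 10, Lemmas 6.3–6.4 and the proof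
of 6.3 pp. 10–13 of the arXiv version, which treats `det_3` and `perm_3` simultaneously:
"Let `det(A) ∈ {±det_3, ±per_3}`").

## The printed proof and this formalisation

Exactly as for the permanent half (see the module docstring of
`RankOneDeterminantalExpressionsProofs.lean`), with `per` replaced by `det`:

* **Lemma 6.2** (`rankOne_regular_detPoly_of_succ`): the corner substitution `aeval g`
  (`y₀₀ ↦ y₀`, `y₀ᵥ, yᵤ₀ ↦ 0`, `yᵤ₊₁,ᵥ₊₁ ↦ yᵤᵥ`) with `y₀ ≠ 0` generic
  (`exists_ne_zero_and_le_rank_add_smul`, reused) gives `det = y₀ · det_m` — here by the one-term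
  Laplace expansion of the DETERMINANT along column `0` (`det_of_succ_col_zero`, from Mathlib's
  `Matrix.det_succ_column_zero`) — and rescaling row `0` by `y₀⁻¹` a regular rank-one expression
  of `det_m`.
* **Lemma 6.3** (`detPoly_three_no_rankOne_regular`): normal form `V Λ U = Λ₀`
  (`exists_mul_mul_eq_lamMatrix`), `X^e = c_e r_eᵀ` (`exists_vecMulVec_of_rank_le_one`, reused),
  the Weinstein–Aronszajn identities `det_lamMatrix_add_sum_vecMulVec`, `det_waMatrix_one`,
  `det_waMatrix_two_of_diag`, `pathSum_of_det_waMatrix_three` (reused) evaluated at the indicator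
  vectors of one, two, three cells: (a) `α_e γ_e = 0`, (b) `α_e ρ_{ef} γ_f = 0`, (c) the path
  identity `Σ_{orderings} α ρ ρ γ = κ · det (𝟙_e + 𝟙_f + 𝟙_g)` (IL17 Lemma 6.4 in closed form).
  The **endgame** `endgame_of_pathSums_det` is the determinant twin of `endgame_of_pathSums`: the
  only inputs about the target polynomial are the values of `det` on the indicator matrices of
  the diagonal (`1`), of an anti-diagonal transversal (`-1` instead of the permanent's `1` — only
  non-vanishing matters) and of three cells with an empty row or column (`0`).
* **Assembly** (`ikenmeyerLandsberg2017_det_no_rankOne_regular_holds`): induction on `m ≥ 3`.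

## Contents

1. Small determinants of cell-indicator matrices.  2. The endgame (det).  3. Lemma 6.3 (`m = 3`).
4. One-term Laplace expansion, `det_m(0) = 0`, Lemma 6.2.  5. Theorem 2.9 (det half).
-/

noncomputable section

open Matrix MvPolynomial

namespace Literature.Computability.AlgebraicComplexity

/-! ### 1. Small determinants of cell-indicator matrices -/

section SmallDeterminants

variable {K : Type*} [Field K]

/-- The anti-diagonal transversal through `(i₂,i₂)`: the indicator matrix of the cells
`(i₁,i₃), (i₂,i₂), (i₃,i₁)` is a transposition matrix, of determinant `-1`. [folklore] -/
theorem det_cells_swap {i₁ i₂ i₃ : Fin 3} (h12 : i₁ ≠ i₂) (h13 : i₁ ≠ i₃) (h23 : i₂ ≠ i₃) :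
    (Matrix.of fun i j : Fin 3 => (if (i, j) = (i₁, i₃) then (1 : K) else 0) +
      (if (i, j) = (i₂, i₂) then 1 else 0) +
        (if (i, j) = (i₃, i₁) then 1 else 0)).det = -1 := by
  fin_cases i₁ <;> fin_cases i₂ <;> fin_cases i₃ <;>
    simp [det_fin_three] at h12 h13 h23 ⊢

/-- Three cells `(i₁,i₁), (i₂,i₂), (i₃,i₁)` leave column `i₃` empty: determinant `0`. [folklore] -/
theorem det_cells_col {i₁ i₂ i₃ : Fin 3} (h12 : i₁ ≠ i₂) (h13 : i₁ ≠ i₃) (h23 : i₂ ≠ i₃) :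
    (Matrix.of fun i j : Fin 3 => (if (i, j) = (i₁, i₁) then (1 : K) else 0) +
      (if (i, j) = (i₂, i₂) then 1 else 0) +
        (if (i, j) = (i₃, i₁) then 1 else 0)).det = 0 := by
  fin_cases i₁ <;> fin_cases i₂ <;> fin_cases i₃ <;>
    simp [det_fin_three] at h12 h13 h23 ⊢

/-- Three cells `(i₁,i₁), (i₂,i₂), (i₁,i₃)` leave row `i₃` empty: determinant `0`. [folklore] -/
theorem det_cells_row {i₁ i₂ i₃ : Fin 3} (h12 : i₁ ≠ i₂) (h13 : i₁ ≠ i₃) (h23 : i₂ ≠ i₃) :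
    (Matrix.of fun i j : Fin 3 => (if (i, j) = (i₁, i₁) then (1 : K) else 0) +
      (if (i, j) = (i₂, i₂) then 1 else 0) +
        (if (i, j) = (i₁, i₃) then 1 else 0)).det = 0 := by
  fin_cases i₁ <;> fin_cases i₂ <;> fin_cases i₃ <;>
    simp [det_fin_three] at h12 h13 h23 ⊢

/-- The diagonal: the indicator matrix of `(0,0), (1,1), (2,2)` is `1`, determinant `1`. [folklore] -/
theorem det_cells_diag :
    (Matrix.of fun i j : Fin 3 => (if (i, j) = ((0 : Fin 3), (0 : Fin 3)) then (1 : K) else 0) +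
      (if (i, j) = ((1 : Fin 3), (1 : Fin 3)) then 1 else 0) +
        (if (i, j) = ((2 : Fin 3), (2 : Fin 3)) then 1 else 0)).det = 1 := by
  simp [det_fin_three]

/-- For at most `q` marked cells avoiding column `j₀`, the indicator matrix is singular.
[folklore] -/
theorem det_cells_eq_zero_of_col {q : ℕ} (t : Fin q → Fin 3 × Fin 3) (j₀ : Fin 3)
    (ht : ∀ l, (t l).2 ≠ j₀) :
    (Matrix.of fun i j : Fin 3 => ∑ l, if (i, j) = t l then (1 : K) else 0).det = 0 := by
  refine det_eq_zero_of_column_eq_zero j₀ fun i => ?_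
  rw [Matrix.of_apply]
  refine Finset.sum_eq_zero fun l _ => if_neg fun h => ht l ?_
  rw [← h]

end SmallDeterminants

/-! ### 2. The endgame: path sums cannot reproduce `det_3` -/

section Endgame

variable {K : Type*} [Field K]

/-- **Endgame, determinant version** (the combinatorial heart of IL17 Lemma 6.3 for `det_3`,
cf. Lemma 6.4 and cases (10e), (14c), (16b) of its proof; twin of `endgame_of_pathSums`). Data
`α, γ : cells → K`, `ρ : cells² → K`, `κ ≠ 0` with (a) `α_e γ_e = 0`, (b) `α_e ρ_{ef} γ_f = 0`
and (c) the path identity `Σ_{orderings} α ρ ρ γ = κ · det(𝟙_e + 𝟙_f + 𝟙_g)` for all cells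
`e, f, g` cannot exist.  Proof: the diagonal carries a nonzero path `(i₁,i₁) → (i₂,i₂) → (i₃,i₃)`,
forcing `α (i₂,i₂) = γ (i₂,i₂) = 0`; the anti-diagonal `{(i₁,i₃),(i₂,i₂),(i₃,i₁)}` (determinant
`-1 ≠ 0`) then carries `(i₁,i₃) → (i₂,i₂) → (i₃,i₁)` or its reverse; splicing gives a nonzero
path on `{(i₁,i₁),(i₂,i₂),(i₃,i₁)}` (column `i₃` empty) or on `{(i₁,i₁),(i₂,i₂),(i₁,i₃)}` (row
`i₃` empty), whose path sum must vanish. [cite: IkenmeyerLandsberg2017, Lemma 6.3] -/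
theorem endgame_of_pathSums_det {α γ : Fin 3 × Fin 3 → K}
    {ρ : Fin 3 × Fin 3 → Fin 3 × Fin 3 → K} {κ : K} (hκ : κ ≠ 0) (hN : ∀ e, α e * γ e = 0)
    (hM : ∀ e f, α e * ρ e f * γ f = 0)
    (hP : ∀ e f g : Fin 3 × Fin 3,
      α e * ρ e f * ρ f g * γ g + α e * ρ e g * ρ g f * γ f + α f * ρ f e * ρ e g * γ g +
          α f * ρ f g * ρ g e * γ e + α g * ρ g e * ρ e f * γ f + α g * ρ g f * ρ f e * γ e =
        κ * (Matrix.of fun i j : Fin 3 => (if (i, j) = e then (1 : K) else 0) +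
          (if (i, j) = f then 1 else 0) + (if (i, j) = g then 1 else 0)).det) :
    False := by
  -- Step 1: the diagonal transversal carries a nonzero path `(i₁,i₁) → (i₂,i₂) → (i₃,i₃)`.
  have hdiag := hP (0, 0) (1, 1) (2, 2)
  rw [det_cells_diag, mul_one] at hdiag
  obtain ⟨i₁, i₂, i₃, h12, h13, h23, hw⟩ : ∃ i₁ i₂ i₃ : Fin 3, i₁ ≠ i₂ ∧ i₁ ≠ i₃ ∧ i₂ ≠ i₃ ∧
      α (i₁, i₁) * ρ (i₁, i₁) (i₂, i₂) * ρ (i₂, i₂) (i₃, i₃) * γ (i₃, i₃) ≠ 0 := by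
    by_contra hcon
    push Not at hcon
    apply hκ
    rw [← hdiag, hcon 0 1 2 (by decide) (by decide) (by decide),
      hcon 0 2 1 (by decide) (by decide) (by decide),
      hcon 1 0 2 (by decide) (by decide) (by decide),
      hcon 1 2 0 (by decide) (by decide) (by decide),
      hcon 2 0 1 (by decide) (by decide) (by decide),
      hcon 2 1 0 (by decide) (by decide) (by decide)]
    ring
  -- Step 2: the classes of the three diagonal cells.
  have hαa : α (i₁, i₁) ≠ 0 := fun h => hw (by rw [h]; ring)
  have hρab : ρ (i₁, i₁) (i₂, i₂) ≠ 0 := fun h => hw (by rw [h]; ring)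
  have hρbc : ρ (i₂, i₂) (i₃, i₃) ≠ 0 := fun h => hw (by rw [h]; ring)
  have hγc : γ (i₃, i₃) ≠ 0 := fun h => hw (by rw [h]; ring)
  have hγa : γ (i₁, i₁) = 0 := (mul_eq_zero.mp (hN _)).resolve_left hαa
  have hαb : α (i₂, i₂) = 0 := by
    by_contra h
    rcases mul_eq_zero.mp (hM (i₂, i₂) (i₃, i₃)) with h' | h'
    · rcases mul_eq_zero.mp h' with h'' | h''
      · exact h h''
      · exact hρbc h''
    · exact hγc h'
  have hγb : γ (i₂, i₂) = 0 := by
    by_contra h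
    rcases mul_eq_zero.mp (hM (i₁, i₁) (i₂, i₂)) with h' | h'
    · rcases mul_eq_zero.mp h' with h'' | h''
      · exact hαa h''
      · exact hρab h''
    · exact h h'
  -- Step 3: the anti-diagonal transversal through `(i₂,i₂)` (a transposition: `det = -1`).
  have hx := hP (i₁, i₃) (i₂, i₂) (i₃, i₁)
  rw [det_cells_swap h12 h13 h23, mul_neg, mul_one] at hx
  simp only [hαb, hγb, zero_mul, mul_zero, add_zero] at hx
  -- Step 4: splice.
  by_cases hA : α (i₁, i₃) * ρ (i₁, i₃) (i₂, i₂) * ρ (i₂, i₂) (i₃, i₁) * γ (i₃, i₁) = 0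
  · -- the reverse path `(i₃,i₁) → (i₂,i₂) → (i₁,i₃)` is nonzero
    rw [hA, zero_add] at hx
    have hρbx : ρ (i₂, i₂) (i₁, i₃) ≠ 0 := fun h => hκ (neg_eq_zero.mp (by rw [← hx, h]; ring))
    have hγx : γ (i₁, i₃) ≠ 0 := fun h => hκ (neg_eq_zero.mp (by rw [← hx, h]; ring))
    have hN' := hP (i₁, i₁) (i₂, i₂) (i₁, i₃)
    rw [det_cells_row h12 h13 h23, mul_zero] at hN'
    simp only [hαb, hγb, hγa, zero_mul, mul_zero, add_zero] at hN'
    exact mul_ne_zero (mul_ne_zero (mul_ne_zero hαa hρab) hρbx) hγx hN'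
  · have hρbx : ρ (i₂, i₂) (i₃, i₁) ≠ 0 := fun h => hA (by rw [h]; ring)
    have hγx : γ (i₃, i₁) ≠ 0 := fun h => hA (by rw [h]; ring)
    have hN' := hP (i₁, i₁) (i₂, i₂) (i₃, i₁)
    rw [det_cells_col h12 h13 h23, mul_zero] at hN'
    simp only [hαb, hγb, hγa, zero_mul, mul_zero, add_zero] at hN'
    exact mul_ne_zero (mul_ne_zero (mul_ne_zero hαa hρab) hρbx) hγx hN'

end Endgame

/-! ### 3. The case `m = 3` (IL17 Lemma 6.3, determinant) -/

section Three

/-- **IL17 Lemma 6.3 (determinant)**: `det_3` has no regular rank-one affine determinantal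
representation over `ℂ`. Proof: evaluation `det (Λ + Σ y_e X^e) = det (y)` (`LRPencil.map_eval_eq`,
`eval_detPoly`), `X^e = c_e r_eᵀ`, normal form `V Λ U = Λ₀`, Weinstein–Aronszajn at the
indicators of one, two, three cells, and `endgame_of_pathSums_det`.
[cite: IkenmeyerLandsberg2017, Lemma 6.3] -/
theorem detPoly_three_no_rankOne_regular {n : ℕ}
    (A : Matrix (Fin n) (Fin n) (MvPolynomial (Fin 3 × Fin 3) ℂ))
    (hA : IsAffineDetRepr (detPoly (Fin 3) ℂ) A)
    (hreg : (A.map MvPolynomial.constantCoeff).rank + 1 = n)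
    (h1 : ∀ e : Fin 3 × Fin 3,
      (Matrix.of fun i j => MvPolynomial.coeff (Finsupp.single e 1) (A i j)).rank ≤ 1) :
    False := by
  classical
  -- (1) evaluation: `det (Λ + Σ_e y_e X^e) = det (y)`
  have heval : ∀ y : Fin 3 × Fin 3 → ℂ,
      (constPart A + ∑ e, y e • LRPencil.coeffMat A e).det =
        (Matrix.of fun i j => y (i, j)).det := fun y => by
    have h := RingHom.map_det (MvPolynomial.eval y) A
    rw [RingHom.mapMatrix_apply, LRPencil.map_eval_eq A hA.1 y, hA.2, eval_detPoly] at h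
    exact h.symm
  -- (2) rank one: `X^e = c_e r_eᵀ`
  have h1' : ∀ e, (LRPencil.coeffMat A e).rank ≤ 1 := h1
  choose c r hcr using fun e => exists_vecMulVec_of_rank_le_one (LRPencil.coeffMat A e) (h1' e)
  -- (3) normal form of `Λ`
  obtain ⟨V, U, i₀, hV, hU, hVU⟩ := exists_mul_mul_eq_lamMatrix (constPart A)
    (by rw [Fintype.card_fin]; change (A.map constantCoeff).rank = n - 1; omega)
    (by rw [Fintype.card_fin]; omega)
  have hκ : V.det * U.det ≠ 0 :=
    mul_ne_zero ((Matrix.isUnit_iff_isUnit_det V).mp hV).ne_zero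
      ((Matrix.isUnit_iff_isUnit_det U).mp hU).ne_zero
  -- (4) the key identity, for every `y`
  have key : ∀ y : Fin 3 × Fin 3 → ℂ,
      (lamMatrix ℂ i₀ + ∑ e, y e • vecMulVec (V *ᵥ c e) (r e ᵥ* U)).det =
        V.det * U.det * (Matrix.of fun i j => y (i, j)).det := fun y => by
    have hconj : V * (constPart A + ∑ e, y e • LRPencil.coeffMat A e) * U =
        lamMatrix ℂ i₀ + ∑ e, y e • vecMulVec (V *ᵥ c e) (r e ᵥ* U) := by
      rw [Matrix.mul_add, Matrix.add_mul, hVU, Finset.mul_sum, Finset.sum_mul]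
      refine congrArg _ (Finset.sum_congr rfl fun e _ => ?_)
      rw [Matrix.mul_smul, Matrix.smul_mul, hcr e, Matrix.mul_vecMulVec, Matrix.vecMulVec_mul]
    rw [← hconj, det_mul, det_mul, heval y]
    ring
  -- (5) the key identity at indicator vectors of `q` cells
  have keyt : ∀ {q : ℕ} (t : Fin q → Fin 3 × Fin 3),
      (lamMatrix ℂ i₀ + ∑ l, vecMulVec (V *ᵥ c (t l)) (r (t l) ᵥ* U)).det =
        V.det * U.det *
          (Matrix.of fun i j : Fin 3 => ∑ l, if (i, j) = t l then (1 : ℂ) else 0).det := by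
    intro q t
    have h := key (fun x => ∑ l, if x = t l then (1 : ℂ) else 0)
    rwa [sum_indicator_smul] at h
  -- (a) one cell: `α_e γ_e = 0`
  have hN : ∀ e, (V *ᵥ c e) i₀ * (r e ᵥ* U) i₀ = 0 := fun e => by
    have h := keyt ![e]
    have hne : ∀ l : Fin 1, (![e] l).2 ≠ e.2 + 1 := fun l => by
      fin_cases l; simp
    rw [det_lamMatrix_add_sum_vecMulVec, det_waMatrix_one, det_cells_eq_zero_of_col _ _ hne,
      mul_zero] at h
    simpa using h
  -- (b) two cells: `α_e ρ_ef γ_f + α_f ρ_fe γ_e = 0`, hence `α_e ρ_ef γ_f = 0`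
  have hB : ∀ e f, (V *ᵥ c e) i₀ * (r e ᵥ* U ⬝ᵥ V *ᵥ c f) * (r f ᵥ* U) i₀ +
      (V *ᵥ c f) i₀ * (r f ᵥ* U ⬝ᵥ V *ᵥ c e) * (r e ᵥ* U) i₀ = 0 := fun e f => by
    have h := keyt ![e, f]
    obtain ⟨j₀, hj₀e, hj₀f⟩ := exists_fin_three_ne_ne e.2 f.2
    have hne : ∀ l : Fin 2, (![e, f] l).2 ≠ j₀ := fun l => by
      fin_cases l
      · simpa using hj₀e.symm
      · simpa using hj₀f.symm
    rw [det_lamMatrix_add_sum_vecMulVec,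
      det_waMatrix_two_of_diag (fun k => (V *ᵥ c (![e, f] k)) i₀) (fun l => (r (![e, f] l) ᵥ* U) i₀)
        (fun l k => r (![e, f] l) ᵥ* U ⬝ᵥ V *ᵥ c (![e, f] k)) (fun l => hN _),
      det_cells_eq_zero_of_col _ _ hne, mul_zero, neg_eq_zero] at h
    simpa using h
  have hM : ∀ e f, (V *ᵥ c e) i₀ * (r e ᵥ* U ⬝ᵥ V *ᵥ c f) * (r f ᵥ* U) i₀ = 0 := fun e f => by
    by_cases hαe : (V *ᵥ c e) i₀ = 0
    · rw [hαe, zero_mul, zero_mul]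
    by_cases hγf : (r f ᵥ* U) i₀ = 0
    · rw [hγf, mul_zero]
    have hγe : (r e ᵥ* U) i₀ = 0 := (mul_eq_zero.mp (hN e)).resolve_left hαe
    have h := hB e f
    rwa [hγe, mul_zero, add_zero] at h
  -- (c) three cells: the path identity
  have hP : ∀ e f g : Fin 3 × Fin 3,
      (V *ᵥ c e) i₀ * (r e ᵥ* U ⬝ᵥ V *ᵥ c f) * (r f ᵥ* U ⬝ᵥ V *ᵥ c g) * (r g ᵥ* U) i₀ +
      (V *ᵥ c e) i₀ * (r e ᵥ* U ⬝ᵥ V *ᵥ c g) * (r g ᵥ* U ⬝ᵥ V *ᵥ c f) * (r f ᵥ* U) i₀ +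
      (V *ᵥ c f) i₀ * (r f ᵥ* U ⬝ᵥ V *ᵥ c e) * (r e ᵥ* U ⬝ᵥ V *ᵥ c g) * (r g ᵥ* U) i₀ +
      (V *ᵥ c f) i₀ * (r f ᵥ* U ⬝ᵥ V *ᵥ c g) * (r g ᵥ* U ⬝ᵥ V *ᵥ c e) * (r e ᵥ* U) i₀ +
      (V *ᵥ c g) i₀ * (r g ᵥ* U ⬝ᵥ V *ᵥ c e) * (r e ᵥ* U ⬝ᵥ V *ᵥ c f) * (r f ᵥ* U) i₀ +
      (V *ᵥ c g) i₀ * (r g ᵥ* U ⬝ᵥ V *ᵥ c f) * (r f ᵥ* U ⬝ᵥ V *ᵥ c e) * (r e ᵥ* U) i₀ =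
        V.det * U.det * (Matrix.of fun i j : Fin 3 => (if (i, j) = e then (1 : ℂ) else 0) +
          (if (i, j) = f then 1 else 0) + (if (i, j) = g then 1 else 0)).det := by
    intro e f g
    have h := keyt ![e, f, g]
    rw [det_lamMatrix_add_sum_vecMulVec,
      pathSum_of_det_waMatrix_three (fun k => (V *ᵥ c (![e, f, g] k)) i₀)
        (fun l => (r (![e, f, g] l) ᵥ* U) i₀)
        (fun l k => r (![e, f, g] l) ᵥ* U ⬝ᵥ V *ᵥ c (![e, f, g] k))
        (fun l => hN _) (fun l k => hM _ _)] at h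
    simp only [Fin.sum_univ_three, Matrix.cons_val_zero, Matrix.cons_val_one, Matrix.cons_val_two,
      Matrix.tail_cons, Matrix.head_cons] at h
    exact h
  exact endgame_of_pathSums_det (α := fun e => (V *ᵥ c e) i₀) (γ := fun e => (r e ᵥ* U) i₀)
    (ρ := fun e f => r e ᵥ* U ⬝ᵥ V *ᵥ c f) hκ hN hM hP

end Three

/-! ### 4. IL17 Lemma 6.2: a regular rank-one expression of `det_{m+1}` yields one of `det_m` -/

section Reduction

/-- One-term Laplace expansion of a determinant: if column `0` vanishes below the corner then
`det A = A₀₀ · det (A with row and column 0 deleted)` (`Matrix.det_succ_column_zero`). [folklore] -/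
theorem det_of_succ_col_zero {R : Type*} [CommRing R] {n : ℕ}
    (A : Matrix (Fin (n + 1)) (Fin (n + 1)) R) (h : ∀ i : Fin n, A i.succ 0 = 0) :
    A.det = A 0 0 * (A.submatrix Fin.succ Fin.succ).det := by
  rw [det_succ_column_zero, Fin.sum_univ_succ, Fin.succAbove_zero]
  simp [h]

/-- `det_m` has no constant term (`m ≥ 1`): `det_m(0) = det 0 = 0`. [folklore] -/
theorem constantCoeff_detPoly (R : Type*) [CommRing R] {m : ℕ} (hm : 1 ≤ m) :
    constantCoeff (detPoly (Fin m) R) = 0 := by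
  have h0 : MvPolynomial.eval (0 : Fin m × Fin m → R) (detPoly (Fin m) R) = 0 := by
    rw [eval_detPoly]
    have hz : (Matrix.of fun i j : Fin m => (0 : Fin m × Fin m → R) (i, j)) = 0 := by
      ext i j; rfl
    rw [hz]
    haveI : Nonempty (Fin m) := ⟨⟨0, hm⟩⟩
    exact Matrix.det_zero
  rwa [MvPolynomial.eval_zero] at h0

/-- **IL17 Lemma 6.2** (regular rank-`1` case, determinant): if `det_{m+1}` (`m ≥ 1`) has a
regular rank-one affine determinantal representation of size `n` over `ℂ`, so does `det_m`.
Same construction as `rankOne_regular_perPoly_of_succ` (corner substitution `aeval g` with a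
generic corner value `y₀ ≠ 0`, `exists_ne_zero_and_le_rank_add_smul`; rescaling of row `0` by
`y₀⁻¹`), the identity `det = y₀ · det_m` now coming from the one-term Laplace expansion of the
determinant (`det_of_succ_col_zero`) and `rank ≤ n - 1` from `det_m(0) = 0`
(`constantCoeff_detPoly`). [cite: IkenmeyerLandsberg2017, Lemma 6.2] -/
theorem rankOne_regular_detPoly_of_succ {m : ℕ} (hm : 1 ≤ m) {n : ℕ}
    (A : Matrix (Fin n) (Fin n) (MvPolynomial (Fin (m + 1) × Fin (m + 1)) ℂ))
    (hA : IsAffineDetRepr (detPoly (Fin (m + 1)) ℂ) A)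
    (hreg : (A.map MvPolynomial.constantCoeff).rank + 1 = n)
    (h1 : ∀ e : Fin (m + 1) × Fin (m + 1),
      (Matrix.of fun i j => MvPolynomial.coeff (Finsupp.single e 1) (A i j)).rank ≤ 1) :
    ∃ B : Matrix (Fin n) (Fin n) (MvPolynomial (Fin m × Fin m) ℂ),
      IsAffineDetRepr (detPoly (Fin m) ℂ) B ∧ (B.map MvPolynomial.constantCoeff).rank + 1 = n ∧
        ∀ e : Fin m × Fin m,
          (Matrix.of fun i j => MvPolynomial.coeff (Finsupp.single e 1) (B i j)).rank ≤ 1 := by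
  classical
  have h1' : ∀ e, (LRPencil.coeffMat A e).rank ≤ 1 := h1
  -- generic `y₀`
  obtain ⟨y₀, hy₀, hrank⟩ :=
    exists_ne_zero_and_le_rank_add_smul (constPart A) (LRPencil.coeffMat A (0, 0)) hreg
  -- the corner substitution `g`: `y₀₀ ↦ y₀`, `y₀ᵥ, yᵤ₀ ↦ 0`, `yᵤ₊₁,ᵥ₊₁ ↦ yᵤᵥ`
  let g : Fin (m + 1) × Fin (m + 1) → MvPolynomial (Fin m × Fin m) ℂ := fun uv =>
    Fin.cases (motive := fun _ => MvPolynomial (Fin m × Fin m) ℂ)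
      (Fin.cases (motive := fun _ => MvPolynomial (Fin m × Fin m) ℂ) (C y₀) (fun _ => 0) uv.2)
      (fun u => Fin.cases (motive := fun _ => MvPolynomial (Fin m × Fin m) ℂ) 0
        (fun v => X (u, v)) uv.2) uv.1
  have g00 : g (0, 0) = C y₀ := rfl
  have g0s : ∀ v : Fin m, g (0, v.succ) = 0 := fun v => rfl
  have gs0 : ∀ u : Fin m, g (u.succ, 0) = 0 := fun u => rfl
  have gss : ∀ u v : Fin m, g (u.succ, v.succ) = X (u, v) := fun u v => rfl
  have hg_cases : ∀ {P : MvPolynomial (Fin m × Fin m) ℂ → Prop},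
      P (C y₀) → P 0 → (∀ u v, P (X (u, v))) → ∀ e, P (g e) := by
    intro P hC h0 hX ⟨u, v⟩
    refine Fin.cases ?_ (fun u' => ?_) u <;> refine Fin.cases ?_ (fun v' => ?_) v
    · exact hC
    · rw [g0s]; exact h0
    · rw [gs0]; exact h0
    · rw [gss]; exact hX _ _
  set φ : MvPolynomial (Fin (m + 1) × Fin (m + 1)) ℂ →ₐ[ℂ] MvPolynomial (Fin m × Fin m) ℂ :=
    aeval g with hφ
  -- entries of `φ A`
  have hφA : ∀ i j, φ (A i j) = C (coeff 0 (A i j)) +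
      ∑ e, C (coeff (Finsupp.single e 1) (A i j)) * g e := fun i j => by
    conv_lhs => rw [LRPencil.eq_affine_of_totalDegree_le_one (A i j) (hA.1 i j)]
    simp [hφ, map_sum, MvPolynomial.algebraMap_eq]
  -- the rescaled matrix `B = diag(y₀⁻¹, 1, …, 1) · φ(A)`
  have hn : 0 < n := by omega
  set d : Fin n → ℂ := fun i => if i = ⟨0, hn⟩ then y₀⁻¹ else 1 with hd
  set B : Matrix (Fin n) (Fin n) (MvPolynomial (Fin m × Fin m) ℂ) :=
    Matrix.of fun i j => C (d i) * φ (A i j) with hB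
  have hBeq : B = (Matrix.diagonal d).map C * A.map φ := by
    rw [Matrix.diagonal_map (map_zero C)]
    ext i j
    rw [Matrix.diagonal_mul, hB, Matrix.of_apply, Matrix.map_apply]
  have hdunit : IsUnit (Matrix.diagonal d).det := by
    rw [det_diagonal]
    simp [hd, Finset.prod_ite_eq', hy₀]
  -- (i) degrees
  have hg1 : ∀ e, (g e).totalDegree ≤ 1 :=
    hg_cases (P := fun p => p.totalDegree ≤ 1) (by simp) (by simp) (fun u v => by simp)
  have hdegB : ∀ i j, (B i j).totalDegree ≤ 1 := fun i j => by
    rw [hB, Matrix.of_apply]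
    refine (totalDegree_mul _ _).trans ?_
    rw [totalDegree_C, zero_add, hφA]
    refine (totalDegree_add _ _).trans (max_le (by simp) ?_)
    refine totalDegree_finsetSum_le fun e _ => (totalDegree_mul _ _).trans ?_
    rw [totalDegree_C, zero_add]
    exact hg1 e
  -- (ii) determinant: `φ (det_{m+1}) = y₀ · det_m` (one-term Laplace expansion along column `0`)
  have hdetm : φ (detPoly (Fin (m + 1)) ℂ) = C y₀ * detPoly (Fin m) ℂ := by
    have hφdet : φ (detPoly (Fin (m + 1)) ℂ) = (Matrix.of fun i j => g (i, j)).det := by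
      rw [detPoly, AlgHom.map_det]
      congr 1
      ext i j
      simp [hφ, Matrix.mvPolynomialX_apply]
    rw [hφdet, det_of_succ_col_zero _ (fun i => gs0 i), Matrix.of_apply, g00]
    -- the complementary block is literally `Matrix.mvPolynomialX (Fin m) (Fin m) ℂ`
    rfl
  have hdetB : B.det = detPoly (Fin m) ℂ := by
    have hdd : ((Matrix.diagonal d).map (C : ℂ →+* MvPolynomial (Fin m × Fin m) ℂ)).det =
        C y₀⁻¹ := by
      rw [← RingHom.mapMatrix_apply, ← RingHom.map_det, det_diagonal]
      simp [hd, Finset.prod_ite_eq']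
    rw [hBeq, det_mul, hdd, ← AlgHom.mapMatrix_apply, ← AlgHom.map_det, hA.2, hdetm, ← mul_assoc,
      ← map_mul, inv_mul_cancel₀ hy₀, map_one, one_mul]
  -- (iii) constant parts: `B(0) = diag(d) (Λ + y₀ X^{(0,0)})`
  have hg0 : ∀ e, constantCoeff (g e) = if e = (0, 0) then y₀ else 0 := by
    rintro ⟨u, v⟩
    refine Fin.cases ?_ (fun u' => ?_) u <;> refine Fin.cases ?_ (fun v' => ?_) v
    · rw [g00, constantCoeff_C, if_pos rfl]
    · rw [g0s, map_zero, if_neg (by simp [Fin.succ_ne_zero])]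
    · rw [gs0, map_zero, if_neg (by simp [Fin.succ_ne_zero])]
    · rw [gss, constantCoeff_X, if_neg (by simp [Fin.succ_ne_zero])]
  have hconstB : B.map constantCoeff =
      Matrix.diagonal d * (constPart A + y₀ • LRPencil.coeffMat A (0, 0)) := by
    ext i j
    rw [Matrix.map_apply, hB, Matrix.of_apply, map_mul, constantCoeff_C, hφA, Matrix.diagonal_mul]
    simp only [map_add, map_sum, map_mul, constantCoeff_C, hg0, mul_ite, mul_zero,
      Finset.sum_ite_eq', Finset.mem_univ, if_true, Matrix.add_apply, constPart_apply,
      Matrix.smul_apply, LRPencil.coeffMat_apply, smul_eq_mul, constantCoeff_eq]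
    ring
  -- (iv) coefficient matrices: `coeffMat B (a,b) = diag(d) · coeffMat A (a+1, b+1)`
  have hgc : ∀ (e' : Fin m × Fin m) (e : Fin (m + 1) × Fin (m + 1)),
      coeff (Finsupp.single e' 1) (g e) = if e = (e'.1.succ, e'.2.succ) then 1 else 0 := by
    rintro ⟨a, b⟩ ⟨u, v⟩
    have h0 : ¬ ((0 : Fin m × Fin m →₀ ℕ) = Finsupp.single (a, b) 1) := fun h =>
      one_ne_zero (Finsupp.single_eq_zero.mp h.symm)
    refine Fin.cases ?_ (fun u' => ?_) u <;> refine Fin.cases ?_ (fun v' => ?_) v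
    · rw [g00, coeff_C, if_neg h0, if_neg (by simp [(Fin.succ_ne_zero _).symm])]
    · rw [g0s, coeff_zero, if_neg (by simp [(Fin.succ_ne_zero _).symm])]
    · rw [gs0, coeff_zero, if_neg (by simp [(Fin.succ_ne_zero _).symm])]
    · rw [gss, MvPolynomial.coeff_X]
      simp [Finsupp.single_left_inj one_ne_zero, Prod.ext_iff]
  have hcoeffB : ∀ e' : Fin m × Fin m, LRPencil.coeffMat B e' =
      Matrix.diagonal d * LRPencil.coeffMat A (e'.1.succ, e'.2.succ) := fun e' => by
    have h0 : ¬ ((0 : Fin m × Fin m →₀ ℕ) = Finsupp.single e' 1) := fun h =>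
      one_ne_zero (Finsupp.single_eq_zero.mp h.symm)
    ext i j
    rw [LRPencil.coeffMat_apply, hB, Matrix.of_apply, coeff_C_mul, hφA, Matrix.diagonal_mul,
      LRPencil.coeffMat_apply]
    simp only [coeff_add, coeff_C, if_neg h0, coeff_sum, coeff_C_mul, hgc, mul_ite, mul_one,
      mul_zero, Finset.sum_ite_eq', Finset.mem_univ, if_true, zero_add]
  -- conclusion
  refine ⟨B, ⟨hdegB, hdetB⟩, le_antisymm ?_ ?_, fun e' => ?_⟩
  · have hdet0 : (B.map constantCoeff).det = 0 := by
      rw [← RingHom.mapMatrix_apply, ← RingHom.map_det, hdetB, constantCoeff_detPoly ℂ hm]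
    have h := Matrix.rank_lt_card_of_det_eq_zero hdet0
    rw [Fintype.card_fin] at h
    omega
  · rw [hconstB, Matrix.rank_mul_eq_right_of_isUnit_det _ _ hdunit]
    exact hrank
  · change (LRPencil.coeffMat B e').rank ≤ 1
    rw [hcoeffB, Matrix.rank_mul_eq_right_of_isUnit_det _ _ hdunit]
    exact h1' _

end Reduction

/-! ### 5. Theorem 2.9 (determinant half) -/

/-- **Ikenmeyer–Landsberg 2017, Theorem 2.9 (determinant half), discharged**: for `m ≥ 3`,
`det_m` admits no regular rank-one affine determinantal representation over `ℂ`, of any size.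
Induction on `m ≥ 3`: Lemma 6.3 (`detPoly_three_no_rankOne_regular`) and Lemma 6.2
(`rankOne_regular_detPoly_of_succ`). [cite: IkenmeyerLandsberg2017, Theorem 2.9] -/
theorem ikenmeyerLandsberg2017_det_no_rankOne_regular_holds :
    ikenmeyerLandsberg2017_det_no_rankOne_regular := by
  intro m hm
  induction m, hm using Nat.le_induction with
  | base => intro n A hA hreg h1; exact detPoly_three_no_rankOne_regular A hA hreg h1
  | succ m hm ih =>
    intro n A hA hreg h1
    obtain ⟨B, hB, hBreg, hB1⟩ := rankOne_regular_detPoly_of_succ (by omega) A hA hreg h1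
    exact ih n B hB hBreg hB1

end Literature.Computability.AlgebraicComplexity
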